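import Summits.Ventures.HodgeRepro2.T5Sl2LowestWeightModel

/-!
# The invariant inner product on the lowest-weight module of weight `μ > 0`

Tier-5 support (N4.3 = (R3), step (P2′): «Bargmann's list» — the discrete series `π₃⁺` is a
UNITARY representation; route/T5-SUPPORT-p1.md §S4.16).  The algebraic core of that unitarity:
on the model `Model ℂ μ` of `T5Sl2LowestWeightModel` with `μ` a positive real, the hermitian form

  `form μ v w = Σₙ conj (vₙ) · wₙ · cₙ`,  `cₙ = ∏_{j < n} (j + 1)(μ + j)`,

is positive definite and invariant under the real form `su(1,1) ⊂ sl₂(ℂ)`: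

* `form_add_left` / `form_add_right` / `form_smul_left` / `form_smul_right` (sesquilinear),
  `form_swap` (hermitian);
* `form_self_eq` / `normSqForm_pos` / `form_self_pos`: `form μ v v = Σ |vₙ|² cₙ > 0` for `v ≠ 0`;
* `form_E₀` / `form_F₀` / `form_H₀`: `E₀* = −F₀`, `F₀* = −E₀`, `H₀* = H₀` for this form;
* `IsSU11 X ↔ Xᴴ J + J X = 0` (`J11 = diag(1, −1)`), `isSU11_entries`, and the invariance
  `form_lie`: for `x ∈ sl₂(ℂ)` with `x.val ∈ su(1,1)`, `form μ ⁅x, v⁆ w = −form μ v ⁅x, w⁆`.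

So the irreducible lowest-weight module of weight `μ > 0` is UNITARIZABLE for `su(1,1)` — the
(𝔤, K)-module side of «the discrete series of lowest weight μ is unitary»; for `μ = 3` this is the
algebraic content behind `π₃⁺` being unitary.

What this file does NOT say: the completion to a Hilbert space and the GROUP representation of
`SU(1,1)` on it (the integration of the Lie algebra action) — printed inputs [C] of (P2′).

Blind lane: Mathlib + own prefix; no sorry; axioms ⊆ {propext, Classical.choice, Quot.sound}.
-/

namespace Summit.Ventures.HodgeRepro2.T5Sl2LowestWeightUnitary

noncomputable section

open LieAlgebra.SpecialLinear LieModule Module Complex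
open Summit.Ventures.HodgeRepro2.T5Sl2Standard Summit.Ventures.HodgeRepro2.T5Sl2LowestWeightModel

variable (μ : ℝ)

/-- The squared norms `cₙ = ∏_{j < n} (j + 1)(μ + j)` of the basis vectors `vₙ`. -/
def normCoeff (n : ℕ) : ℝ := ∏ j ∈ Finset.range n, (((j : ℝ) + 1) * (μ + j))

/-- `c₀ = 1`. -/
lemma normCoeff_zero : normCoeff μ 0 = 1 := by simp [normCoeff]

/-- `cₙ₊₁ = cₙ (n + 1)(μ + n)`. -/
lemma normCoeff_succ (n : ℕ) : normCoeff μ (n + 1) = normCoeff μ n * (((n : ℝ) + 1) * (μ + n)) := by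
  rw [normCoeff, Finset.prod_range_succ, normCoeff]

/-- `cₙ > 0` for `μ > 0`. -/
lemma normCoeff_pos (hμ : 0 < μ) (n : ℕ) : 0 < normCoeff μ n :=
  Finset.prod_pos fun j _ => mul_pos (by positivity) (by positivity)

/-- The hermitian form `form μ v w = Σₙ conj (vₙ) · wₙ · cₙ` on `ℕ →₀ ℂ`. -/
def form (v w : ℕ →₀ ℂ) : ℂ :=
  v.sum fun n a => (starRingEnd ℂ) a * w n * (normCoeff μ n : ℂ)

/-- The form as a sum over any finite set containing the support of the first argument. -/
lemma form_eq_sum (v w : ℕ →₀ ℂ) {s : Finset ℕ} (hs : v.support ⊆ s) :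
    form μ v w = ∑ n ∈ s, (starRingEnd ℂ) (v n) * w n * (normCoeff μ n : ℂ) :=
  Finsupp.sum_of_support_subset v hs _ fun i _ => by simp

/-- The form on basis elements. -/
lemma form_single_single (n k : ℕ) (a b : ℂ) :
    form μ (Finsupp.single n a) (Finsupp.single k b) =
      if n = k then (starRingEnd ℂ) a * b * (normCoeff μ n : ℂ) else 0 := by
  rw [form, Finsupp.sum_single_index (by simp), Finsupp.single_apply]
  by_cases h : n = k
  · subst h; simp
  · simp [h, Ne.symm h]

/-- Additivity in the first argument. -/
lemma form_add_left (v v' w : ℕ →₀ ℂ) : form μ (v + v') w = form μ v w + form μ v' w := by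
  rw [form_eq_sum μ (v + v') w Finsupp.support_add,
    form_eq_sum μ v w Finset.subset_union_left, form_eq_sum μ v' w Finset.subset_union_right,
    ← Finset.sum_add_distrib]
  refine Finset.sum_congr rfl fun n _ => ?_
  simp only [Finsupp.coe_add, Pi.add_apply, map_add]
  ring

/-- Additivity in the second argument. -/
lemma form_add_right (v w w' : ℕ →₀ ℂ) : form μ v (w + w') = form μ v w + form μ v w' := by
  simp only [form, Finsupp.coe_add, Pi.add_apply, mul_add, add_mul]
  exact Finsupp.sum_add

/-- Conjugate-linearity in the first argument. -/
lemma form_smul_left (a : ℂ) (v w : ℕ →₀ ℂ) :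
    form μ (a • v) w = (starRingEnd ℂ) a * form μ v w := by
  rw [form_eq_sum μ (a • v) w (Finsupp.support_smul), form_eq_sum μ v w le_rfl,
    Finset.mul_sum]
  refine Finset.sum_congr rfl fun n _ => ?_
  simp only [Finsupp.coe_smul, Pi.smul_apply, smul_eq_mul, map_mul]
  ring

/-- Linearity in the second argument. -/
lemma form_smul_right (a : ℂ) (v w : ℕ →₀ ℂ) : form μ v (a • w) = a * form μ v w := by
  simp only [form, Finsupp.coe_smul, Pi.smul_apply, smul_eq_mul, Finsupp.mul_sum]
  refine Finset.sum_congr rfl fun n _ => ?_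
  ring

/-- The form on a negated first argument. -/
lemma form_neg_left (v w : ℕ →₀ ℂ) : form μ (-v) w = -form μ v w := by
  rw [← neg_one_smul ℂ v, form_smul_left]
  simp

/-- The form is hermitian. -/
lemma form_swap (v w : ℕ →₀ ℂ) : form μ w v = (starRingEnd ℂ) (form μ v w) := by
  rw [form_eq_sum μ w v (Finset.subset_union_right (s₁ := v.support)),
    form_eq_sum μ v w (Finset.subset_union_left (s₂ := w.support)), map_sum]
  refine Finset.sum_congr rfl fun n _ => ?_
  simp only [map_mul, Complex.conj_conj, Complex.conj_ofReal]
  ring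

/-- The real number `Σₙ |vₙ|² cₙ`. -/
def normSqForm (v : ℕ →₀ ℂ) : ℝ := ∑ n ∈ v.support, Complex.normSq (v n) * normCoeff μ n

/-- `form μ v v` is the real number `Σₙ |vₙ|² cₙ`. -/
lemma form_self_eq (v : ℕ →₀ ℂ) : form μ v v = (normSqForm μ v : ℂ) := by
  rw [form_eq_sum μ v v le_rfl, normSqForm, Complex.ofReal_sum]
  refine Finset.sum_congr rfl fun n _ => ?_
  rw [Complex.ofReal_mul, Complex.normSq_eq_conj_mul_self]

/-- Positivity: `Σₙ |vₙ|² cₙ > 0` for `v ≠ 0` and `μ > 0`. -/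
lemma normSqForm_pos (hμ : 0 < μ) {v : ℕ →₀ ℂ} (hv : v ≠ 0) : 0 < normSqForm μ v :=
  Finset.sum_pos
    (fun n hn => mul_pos (Complex.normSq_pos.mpr (Finsupp.mem_support_iff.mp hn))
      (normCoeff_pos μ hμ n))
    (Finsupp.support_nonempty_iff.mpr hv)

/-- Positive definiteness of the form: `form μ v v` is a positive real for `v ≠ 0`. -/
theorem form_self_pos (hμ : 0 < μ) {v : ℕ →₀ ℂ} (hv : v ≠ 0) :
    0 < (form μ v v).re ∧ (form μ v v).im = 0 := by
  rw [form_self_eq]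
  exact ⟨by simpa using normSqForm_pos μ hμ hv, by simp⟩

section Invariance

/-- `E₀* = −F₀`: `form (E₀ v) w = −form v (F₀ w)`. -/
lemma form_E₀ (v w : ℕ →₀ ℂ) : form μ (E₀ ℂ v) w = -form μ v (F₀ ℂ μ w) := by
  induction v using Finsupp.induction_linear with
  | zero => simp [form]
  | add f g hf hg => rw [map_add, form_add_left, form_add_left, hf, hg, neg_add]
  | single n a =>
    induction w using Finsupp.induction_linear with
    | zero => simp [form]
    | add f g hf hg => rw [map_add, form_add_right, form_add_right, hf, hg, neg_add]
    | single k b =>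
      rw [E₀_single, form_single_single]
      rcases k with _ | k
      · rw [F₀_single_zero]
        simp [form]
      · rw [F₀_single_succ, form_single_single]
        by_cases h : n = k
        · subst h
          simp only [if_true, normCoeff_succ]
          push_cast
          ring
        · simp [h]

/-- `F₀* = −E₀`: `form (F₀ v) w = −form v (E₀ w)`. -/
lemma form_F₀ (v w : ℕ →₀ ℂ) : form μ (F₀ ℂ μ v) w = -form μ v (E₀ ℂ w) := by
  have h : form μ w (F₀ ℂ μ v) = -form μ (E₀ ℂ w) v := by rw [form_E₀, neg_neg]
  rw [form_swap μ w (F₀ ℂ μ v), h, map_neg, form_swap μ v (E₀ ℂ w), Complex.conj_conj]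

/-- `H₀* = H₀`: `form (H₀ v) w = form v (H₀ w)` (the weights are real). -/
lemma form_H₀ (v w : ℕ →₀ ℂ) : form μ (H₀ ℂ μ v) w = form μ v (H₀ ℂ μ w) := by
  induction v using Finsupp.induction_linear with
  | zero => simp [form]
  | add f g hf hg => rw [map_add, form_add_left, form_add_left, hf, hg]
  | single n a =>
    induction w using Finsupp.induction_linear with
    | zero => simp [form]
    | add f g hf hg => rw [map_add, form_add_right, form_add_right, hf, hg]
    | single k b =>
      rw [H₀_single, H₀_single, form_single_single, form_single_single]
      by_cases h : n = k
      · subst h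
        simp only [if_true, map_mul, map_add, Complex.conj_ofReal, map_natCast, map_ofNat]
        ring
      · simp [h]

/-- The hermitian matrix `J11 = diag(1, −1)` of signature `(1, 1)`. -/
def J11 : Matrix (Fin 2) (Fin 2) ℂ := Matrix.diagonal ![1, -1]

/-- `X ∈ su(1,1)`: `Xᴴ J11 + J11 X = 0`. -/
def IsSU11 (X : Matrix (Fin 2) (Fin 2) ℂ) : Prop := Matrix.conjTranspose X * J11 + J11 * X = 0

/-- The entries of an element of `su(1,1)`: `X₀₁ = conj X₁₀` and `conj X₀₀ = −X₀₀`. -/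
lemma isSU11_entries {X : Matrix (Fin 2) (Fin 2) ℂ} (hX : IsSU11 X) :
    X 0 1 = (starRingEnd ℂ) (X 1 0) ∧ (starRingEnd ℂ) (X 0 0) = -X 0 0 := by
  have hX' : Matrix.conjTranspose X * J11 + J11 * X = 0 := hX
  have h01 := congrFun (congrFun hX' 0) 1
  have h00 := congrFun (congrFun hX' 0) 0
  simp only [J11, Matrix.add_apply, Matrix.mul_diagonal, Matrix.diagonal_mul,
    Matrix.conjTranspose_apply, Matrix.zero_apply, Matrix.cons_val_zero, Matrix.cons_val_one,
    Complex.star_def] at h01 h00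
  constructor
  · linear_combination h01
  · linear_combination h00

/-- **Invariance**: for `x ∈ sl₂(ℂ)` with `x.val ∈ su(1,1)`, the operator `rho x` of the model
of weight `μ` is skew-adjoint for the form: `form (rho x v) w = −form v (rho x w)`. -/
theorem form_rho (x : sl (Fin 2) ℂ) (hx : IsSU11 x.val) (v w : ℕ →₀ ℂ) :
    form μ (rho ℂ μ x v) w = -form μ v (rho ℂ μ x w) := by
  obtain ⟨h01, h00⟩ := isSU11_entries hx
  rw [rho_apply]
  simp only [LinearMap.add_apply, LinearMap.smul_apply]
  rw [form_add_left, form_add_left, form_smul_left, form_smul_left, form_smul_left,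
    form_add_right, form_add_right, form_smul_right, form_smul_right, form_smul_right,
    form_E₀, form_F₀, form_H₀, h00]
  have h10 : (starRingEnd ℂ) (x.val 1 0) = x.val 0 1 := by rw [h01]
  rw [h01, Complex.conj_conj, h10]
  ring

/-- **Invariance** in Lie-module form: `form ⁅x, v⁆ w = −form v ⁅x, w⁆` on `Model ℂ μ` for
`x.val ∈ su(1,1)`. -/
theorem form_lie (x : sl (Fin 2) ℂ) (hx : IsSU11 x.val) (v w : Model ℂ (μ : ℂ)) :
    form μ (toFinsupp ℂ μ ⁅x, v⁆) (toFinsupp ℂ μ w) =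
      -form μ (toFinsupp ℂ μ v) (toFinsupp ℂ μ ⁅x, w⁆) :=
  form_rho μ x hx v w

end Invariance

end

end Summit.Ventures.HodgeRepro2.T5Sl2LowestWeightUnitary
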